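import Mathlib
import HarnessLib

/-!
# `AlphaInputsT3ACv3TubeProfile` — (S1) of ★w1-19936 g2's START v3 (`NONABELIAN-FL-START-w1-g2.md` §3 (T)): **ONE UNIVERSAL 2-D LATTICE 1-FORM `β` ON `ℤ²` WITH `curl β = δ_corner − ρ`**, supported in the
# `(2r+1)²` square, `ρ = τ ⊗ τ` the uniform density (`Σρ = 1`, `0 ≤ ρ ≤ 1/(2r+1)²`), `|β_x| ≤ 1/(2r+1)`, `|β_y| ≤ 1` — the profile that smooths the concentrated curvature of the exact section
# `iterSec k V` around an interior edge IN PLACE (tube field `U(b) := exp(−β_e(b)·𝐅_e)·W₀(b)`: in the edge's frame every factor lies in the one-parameter subgroup `exp(ℝ𝐅_e)`, so EXACTLY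
# `U(∂p) = exp(ρ(p)·𝐅_e)` and `dist1 ≤ ‖𝐅_e‖/(2r+1)²`) — cell `ym3-torus`, width seat `ym-ust-19936-w2` (g2), engine letter for the (FL) LEAD

WHY (w1 g2 LOCATED L-3, 2026-08-28T02:15Z: every START that reconciles per-stencil candidates across block-constant frames is k-NONuniform; START v3 keeps the exact section and spreads
each corner line's curvature `𝐅_e` over a tube of radius `r ≍ L^k/8` by a universal commuting profile).  The 2-D content is a compactly supported lattice Poincaré lemma for the zero-mass
2-form `δ₀⊗δ₀ − τ⊗τ`, solved by the TENSOR trick of this seat's (LL) engine: `δ⊗δ − τ⊗τ = (δ−τ)⊗δ + τ⊗(δ−τ)` and `δ − τ = Δh` with `h` the compactly supported partial sum.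
WHAT (definitions on `ℤ`, `ℤ²`; no torus, no gauge field — the LEAD's `…TubeField` transplants them):
* `delta0`, `tau r` (`[|t| ≤ r]/(2r+1)`), `cnt r t` (`#{s ∈ [−r, r] : s < t}` in closed form `max 0 (min (t + r) (2r+1))`), `hstep r t := [0 < t] − cnt r t/(2r+1)` (= `Σ_{s<t}(δ₀ − τ)(s)`),
  `betaX r x y := −τ(x)·h(y)`, `betaY r x y := h(x)·δ₀(y)`, `rho r x y := τ(x)·τ(y)`.
* ★ `hstep_succ_sub : h(t+1) − h(t) = δ₀(t) − τ(t)`; `hstep_eq_zero_of_le`, `hstep_eq_zero_of_lt` (support `(−r, r]`); `abs_hstep_le_one`; `abs_tau_le`, `tau_nonneg`, `tau_eq_zero`;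
* ★★ `curl_beta : betaX r x y + betaY r (x+1) y − betaX r x (y+1) − betaY r x y = delta0 x * delta0 y − rho r x y` (lattice curl `Δ_x β_y − Δ_y β_x` at the plaquette `(x,y)`);
* support ∕ size: `betaX_eq_zero`, `betaY_eq_zero` (off the square; `β_y` lives on the line `y = 0`), `abs_betaX_le` (`≤ 1/(2r+1)`), `abs_betaY_le` (`≤ 1`), `rho_nonneg`, `rho_le` (`≤ 1/(2r+1)²`),
  `rho_eq_zero` (off the square), ★ `sum_tau` (`Σ_{[−r,r]} τ = 1`), ★ `sum_rho` (`Σ_{square} ρ = 1`).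
HONEST FRAMING.  Elementary lattice calculus on `ℤ²`; count-neutral helper toward the (FL) row of 2′∕2′χ (`--supports stmt-QuantumFields-19936`); (FL)∕`hLift`, the stub, the crux and the gap are
NOT claimed; registry untouched.  YM₃ on the three-torus is RUNG R3 of the programme, not the Clay problem.

References: T. Bałaban, Commun. Math. Phys. 102 (1985) 277–309 [Balaban1985Variational] ((11)–(13) pp.279–280: the section and its regularisation); Commun. Math. Phys. 109 (1987) 249–301
[Balaban1987RG1] ((0.4) p.253).
-/

set_option autoImplicit false

noncomputable section

namespace Summit.QuantumFields.YangMills.Theorems.TubeProfile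

open Finset

variable (r : ℕ)

/-! ## §1 The 1-D letters: `δ₀`, the uniform density `τ`, the counting function and the compactly supported antiderivative `h` -/

/-- `δ₀(t) = [t = 0]`. [folklore] -/
def delta0 (t : ℤ) : ℝ := if t = 0 then 1 else 0

/-- The uniform density on `[−r, r]`: `τ(t) = [|t| ≤ r]/(2r+1)`. [folklore] -/
def tau (t : ℤ) : ℝ := if -(r : ℤ) ≤ t ∧ t ≤ r then ((2 * (r : ℝ) + 1))⁻¹ else 0

/-- `cnt r t = #{s ∈ [−r, r] : s < t} = max 0 (min (t + r) (2r+1))`. [folklore] -/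
def cnt (t : ℤ) : ℤ := max 0 (min (t + r) (2 * r + 1))

/-- **THE COMPACTLY SUPPORTED ANTIDERIVATIVE OF `δ₀ − τ`**: `h(t) = Σ_{s<t}(δ₀ − τ)(s) = [0 < t] − cnt(t)/(2r+1)`. [folklore] -/
def hstep (t : ℤ) : ℝ := (if 0 < t then (1 : ℝ) else 0) - (cnt r t : ℝ) * ((2 * (r : ℝ) + 1))⁻¹

/-- The positive normaliser `2r + 1`. [folklore] -/
theorem n_pos : (0 : ℝ) < 2 * (r : ℝ) + 1 := by positivity

/-- `cnt` steps by one exactly on `[−r, r]`. [folklore] -/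
theorem cnt_succ_sub (t : ℤ) : cnt r (t + 1) - cnt r t = if -(r : ℤ) ≤ t ∧ t ≤ r then 1 else 0 := by
  unfold cnt
  split_ifs with h <;> omega

/-- `0 ≤ cnt ≤ 2r+1`. [folklore] -/
theorem cnt_bounds (t : ℤ) : 0 ≤ cnt r t ∧ cnt r t ≤ 2 * r + 1 := by
  unfold cnt; constructor <;> omega

/-- `cnt = 0` to the left of the support, `cnt = 2r+1` to the right, and `cnt ≥ r + 1 > 0` for `t > 0`. [folklore] -/
theorem cnt_of_le {t : ℤ} (ht : t ≤ -(r : ℤ)) : cnt r t = 0 := by unfold cnt; omega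

/-- `cnt = 2r+1` to the right of the support. [folklore] -/
theorem cnt_of_lt {t : ℤ} (ht : (r : ℤ) < t) : cnt r t = 2 * r + 1 := by unfold cnt; omega

/-- **★ `h(t+1) − h(t) = δ₀(t) − τ(t)`** (the discrete derivative of the antiderivative). [folklore] -/
theorem hstep_succ_sub (t : ℤ) : hstep r (t + 1) - hstep r t = delta0 t - tau r t := by
  have hn := n_pos r
  have hc : ((cnt r (t + 1) : ℤ) : ℝ) - (cnt r t : ℝ) = if -(r : ℤ) ≤ t ∧ t ≤ r then 1 else 0 := by
    have := cnt_succ_sub r t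
    split_ifs at this ⊢ with h
    · exact_mod_cast this
    · exact_mod_cast this
  have hA : (if 0 < t + 1 then (1 : ℝ) else 0) - (if 0 < t then (1 : ℝ) else 0) = delta0 t := by
    unfold delta0
    split_ifs <;> first | (exfalso; omega) | norm_num
  have hB : (((cnt r (t + 1) : ℤ) : ℝ) - (cnt r t : ℝ)) * ((2 * (r : ℝ) + 1))⁻¹ = tau r t := by
    rw [hc]; unfold tau
    split_ifs <;> simp
  unfold hstep
  rw [← hA, ← hB]
  ring

/-- `h(t) = 0` for `t ≤ −r` (nothing summed yet). [folklore] -/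
theorem hstep_eq_zero_of_le {t : ℤ} (ht : t ≤ -(r : ℤ)) : hstep r t = 0 := by
  unfold hstep
  rw [cnt_of_le r ht, if_neg (by omega)]
  simp

/-- `h(t) = 0` for `r < t` (total mass `1 − 1 = 0`). [folklore] -/
theorem hstep_eq_zero_of_lt {t : ℤ} (ht : (r : ℤ) < t) : hstep r t = 0 := by
  unfold hstep
  rw [cnt_of_lt r ht, if_pos (by omega)]
  have hn := n_pos r
  push_cast
  field_simp
  ring

/-- **`|h| ≤ 1`** (indeed `h ∈ [−r/(2r+1), r/(2r+1)]`). [folklore] -/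
theorem abs_hstep_le_one (t : ℤ) : |hstep r t| ≤ 1 := by
  have hn := n_pos r
  obtain ⟨h0, h1⟩ := cnt_bounds r t
  have h0' : (0 : ℝ) ≤ (cnt r t : ℝ) := by exact_mod_cast h0
  have h1' : ((cnt r t : ℤ) : ℝ) ≤ 2 * (r : ℝ) + 1 := by exact_mod_cast h1
  have hq0 : 0 ≤ (cnt r t : ℝ) * (2 * (r : ℝ) + 1)⁻¹ := by positivity
  have hq1 : (cnt r t : ℝ) * (2 * (r : ℝ) + 1)⁻¹ ≤ 1 := by
    rw [← div_eq_mul_inv, div_le_one hn]; exact h1'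
  unfold hstep
  rw [abs_le]
  split_ifs <;> constructor <;> linarith

/-- `τ = 0` off `[−r, r]`. [folklore] -/
theorem tau_eq_zero {t : ℤ} (ht : t < -(r : ℤ) ∨ (r : ℤ) < t) : tau r t = 0 := by
  unfold tau; rw [if_neg (by omega)]

/-- `0 ≤ τ ≤ 1/(2r+1)`. [folklore] -/
theorem tau_nonneg (t : ℤ) : 0 ≤ tau r t := by
  unfold tau; split_ifs
  · exact inv_nonneg.mpr (n_pos r).le
  · exact le_rfl

/-- `τ ≤ 1/(2r+1)`. [folklore] -/
theorem tau_le (t : ℤ) : tau r t ≤ ((2 * (r : ℝ) + 1))⁻¹ := by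
  unfold tau; split_ifs
  · exact le_rfl
  · exact inv_nonneg.mpr (n_pos r).le

/-- `|τ| ≤ 1/(2r+1)`. [folklore] -/
theorem abs_tau_le (t : ℤ) : |tau r t| ≤ ((2 * (r : ℝ) + 1))⁻¹ := by
  rw [abs_of_nonneg (tau_nonneg r t)]; exact tau_le r t

/-- **★ `Σ_{t ∈ [−r, r]} τ(t) = 1`.** [folklore] -/
theorem sum_tau : ∑ t ∈ Icc (-(r : ℤ)) r, tau r t = 1 := by
  have hn := n_pos r
  have h : ∀ t ∈ Icc (-(r : ℤ)) r, tau r t = ((2 * (r : ℝ) + 1))⁻¹ := fun t ht => by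
    rw [mem_Icc] at ht; unfold tau; rw [if_pos ht]
  rw [sum_congr rfl h, sum_const, Int.card_Icc, nsmul_eq_mul]
  have e : (((r : ℤ) + 1 - -(r : ℤ)).toNat : ℝ) = 2 * (r : ℝ) + 1 := by
    have : ((r : ℤ) + 1 - -(r : ℤ)).toNat = 2 * r + 1 := by omega
    rw [this]; push_cast; ring
  rw [e, mul_inv_cancel₀ hn.ne']

/-! ## §2 The 2-D profile: `β = (β_x, β_y)` and the spread density `ρ = τ ⊗ τ` -/

/-- `β_x(x, y) = −τ(x)·h(y)` (the 1-form on the bond from `(x,y)` to `(x+1,y)`). [folklore] -/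
def betaX (x y : ℤ) : ℝ := -(tau r x * hstep r y)

/-- `β_y(x, y) = h(x)·δ₀(y)` (the 1-form on the bond from `(x,y)` to `(x,y+1)`; it lives on the line `y = 0`). [folklore] -/
def betaY (x y : ℤ) : ℝ := hstep r x * delta0 y

/-- `ρ(x, y) = τ(x)·τ(y)` (the uniform density on the `(2r+1)²` square). [folklore] -/
def rho (x y : ℤ) : ℝ := tau r x * tau r y

/-- **★★ THE CURL IDENTITY**: at every plaquette `(x, y)` of `ℤ²`, `β_x(x,y) + β_y(x+1,y) − β_x(x,y+1) − β_y(x,y) = δ₀(x)δ₀(y) − ρ(x,y)` — the concentrated unit curvature at the corner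
plaquette minus its uniform spread (`δ⊗δ − τ⊗τ = (δ−τ)⊗δ + τ⊗(δ−τ)`, each factor `δ − τ = Δh`). [cite: Balaban1985Variational, (11)–(13) pp.279–280] -/
theorem curl_beta (x y : ℤ) : betaX r x y + betaY r (x + 1) y - betaX r x (y + 1) - betaY r x y = delta0 x * delta0 y - rho r x y := by
  have hx := hstep_succ_sub r x
  have hy := hstep_succ_sub r y
  unfold betaX betaY rho
  linear_combination (delta0 y) * hx + (tau r x) * hy

/-- `β_x = 0` off the square (indeed off `{|x| ≤ r} × {−r < y ≤ r}`). [folklore] -/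
theorem betaX_eq_zero {x y : ℤ} (h : x < -(r : ℤ) ∨ (r : ℤ) < x ∨ y ≤ -(r : ℤ) ∨ (r : ℤ) < y) : betaX r x y = 0 := by
  unfold betaX
  rcases h with h | h | h | h
  · rw [tau_eq_zero r (Or.inl h)]; ring
  · rw [tau_eq_zero r (Or.inr h)]; ring
  · rw [hstep_eq_zero_of_le r h]; ring
  · rw [hstep_eq_zero_of_lt r h]; ring

/-- `β_y = 0` off the line segment `{−r < x ≤ r} × {y = 0}`. [folklore] -/
theorem betaY_eq_zero {x y : ℤ} (h : x ≤ -(r : ℤ) ∨ (r : ℤ) < x ∨ y ≠ 0) : betaY r x y = 0 := by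
  unfold betaY delta0
  rcases h with h | h | h
  · rw [hstep_eq_zero_of_le r h]; ring
  · rw [hstep_eq_zero_of_lt r h]; ring
  · rw [if_neg h]; ring

/-- **`|β_x| ≤ 1/(2r+1)`.** [folklore] -/
theorem abs_betaX_le (x y : ℤ) : |betaX r x y| ≤ ((2 * (r : ℝ) + 1))⁻¹ := by
  unfold betaX
  rw [abs_neg, abs_mul]
  calc |tau r x| * |hstep r y| ≤ ((2 * (r : ℝ) + 1))⁻¹ * 1 := mul_le_mul (abs_tau_le r x) (abs_hstep_le_one r y) (abs_nonneg _) (inv_nonneg.mpr (n_pos r).le)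
    _ = ((2 * (r : ℝ) + 1))⁻¹ := mul_one _

/-- **`|β_y| ≤ 1`.** [folklore] -/
theorem abs_betaY_le (x y : ℤ) : |betaY r x y| ≤ 1 := by
  unfold betaY delta0
  rw [abs_mul]
  split_ifs
  · rw [abs_one, mul_one]; exact abs_hstep_le_one r x
  · rw [abs_zero, mul_zero]; exact zero_le_one

/-- `0 ≤ ρ ≤ 1/(2r+1)²`, `ρ = 0` off the square. [folklore] -/
theorem rho_nonneg (x y : ℤ) : 0 ≤ rho r x y := mul_nonneg (tau_nonneg r x) (tau_nonneg r y)

/-- `ρ ≤ 1/(2r+1)²`. [folklore] -/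
theorem rho_le (x y : ℤ) : rho r x y ≤ ((2 * (r : ℝ) + 1))⁻¹ ^ 2 := by
  unfold rho; rw [sq]
  exact mul_le_mul (tau_le r x) (tau_le r y) (tau_nonneg r y) (inv_nonneg.mpr (n_pos r).le)

/-- `ρ = 0` off the square. [folklore] -/
theorem rho_eq_zero {x y : ℤ} (h : x < -(r : ℤ) ∨ (r : ℤ) < x ∨ y < -(r : ℤ) ∨ (r : ℤ) < y) : rho r x y = 0 := by
  unfold rho
  rcases h with h | h | h | h
  · rw [tau_eq_zero r (Or.inl h)]; ring
  · rw [tau_eq_zero r (Or.inr h)]; ring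
  · rw [tau_eq_zero r (Or.inl h)]; ring
  · rw [tau_eq_zero r (Or.inr h)]; ring

/-- **★ THE SPREAD DENSITY HAS TOTAL MASS ONE**: `Σ_{(x,y) ∈ [−r,r]²} ρ(x,y) = 1` — so `curl β` has zero mass over the square and the tube field's total flux through the square is exactly the
corner's. [folklore] -/
theorem sum_rho : ∑ x ∈ Icc (-(r : ℤ)) r, ∑ y ∈ Icc (-(r : ℤ)) r, rho r x y = 1 := by
  unfold rho
  simp_rw [← mul_sum, sum_tau, mul_one]
  exact sum_tau r

end Summit.QuantumFields.YangMills.Theorems.TubeProfile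

end
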